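import Literature.NumberTheory.LFunctions.DirichletLTruncationCertificatesFast
import Literature.NumberTheory.LFunctions.FeketePolyaKernelCertificatesResidueTables
import HarnessLib

/-!
# Truncation certificates, engine v3: re-normalised running sums and character values from LITERAL residue
# tables — the same certificates, decided several times faster

Topic `Literature/NumberTheory/LFunctions`; namespace `Literature.NumberTheory.LFunctions.LTruncationCert`
(continues `DirichletLTruncationCertificates{,Odd,Mean,Fast}.lean`).  Small computable definitions (`forceZ`,
`sumsN`, `sumsNegN`, `sumsMeanN`, `certOKT`, `certDriftOKT`, `certMeanOKT`) and THEOREMS; no named fact, no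
`sorry`.  Cell `parity-realchar` (kernel floor of the wide column), prover seat g10.

## What and why (measured on the farm, probe files of this seat, `q = 6015`, `χ₋₆₀₁₅`)

A drift certificate `certDriftOK (valOdd 6015) 6015 1 1 12` costs `≈ 70 s` of kernel time, of which
* `≈ 55 s` is the PERIOD PASS `sumsNeg` (running sums `S`, `U`, `max (−U)⁺`): its accumulators are threaded
  lazily and the running `max` makes the kernel re-normalise ever longer unevaluated sums — the pass is
  QUADRATIC in `q` (`12.6 s` at `3000` terms, `55 s` at `6015`); re-normalising the accumulators at every step
  (the device of `FeketePolyaKernel.run4`: re-match each integer against numeral patterns, cut the index, and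
  keep the running maximum in CONTROL flow) makes it linear: `≈ 4 s` (`sumsNegN`; likewise `sumsN`, `sumsMeanN`
  for `sums`, `sumsMean`; `sumsN_eq`, `sumsNegN_eq`, `sumsMeanN_eq`: equal functions);
* `≈ 13 s` is the binary Jacobi algorithm (`≈ 2.2 ms` per value of `valOdd q n = jac (n % q) q`); the
  Fekete–Pólya lane's residue tables (`FeketePolyaKernelCertificatesResidueTables.lean`, `valOddR tbl n`:
  one `Nat.testBit` per prime factor, `valOddR_eq`) cost `≈ 0.25 ms` per value PROVIDED the table is a literal
  (`resTable ps` left inside the certificate is re-expanded at every lookup): `valOddR_eq_of_table` & co. turn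
  a numeral table `tbl` with `resTable ps = tbl` (checked once by `decide`) into the function equality
  `valOddR tbl = valOdd q`;
* the cell walk (`cellsR`, root tracking, `…Fast.lean`) is the remaining `≈ 5–8 s` at `J = 1` (`≈ 0.45 ms` per
  cell-term, `≈ 0.19 ms` per bisection step where roots are bisected).
The checkers `certOKT` / `certDriftOKT` / `certMeanOKT` are `certOKR` / `certDriftOKR` / `certMeanOKR` with the
re-normalised period passes; they are EQUAL as Booleans to `certOK` / `certDriftOK` / `certMeanOK`
(`certOKT_eq`, `certDriftOKT_eq`, `certMeanOKT_eq`, `T ≤ N₀`), and `certOK_of_eqT` / `certDriftOK_of_eqT` /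
`certMeanOK_of_eqT` move a certificate decided on any value function `w = v` (a literal table) to `v`, so the
soundness theorems `lfunction_ne_zero_of_cert{,Drift,Mean}OK` apply verbatim.  Finally `good_even_of_odd_drift` /
`good_even_of_four_drift` / `good_even_of_eight_drift` are the per-conductor wrappers for EVEN characters over
the drift checker (whose soundness theorem has no parity hypothesis; `B⁻ ≤ B` and `K` periods make it at least
as strong as `certOK`), same statement shape as `good_even_of_*` / `good_odd_of_*`.  Nothing analytic is touched.
[cite: Chua2005RealZeros, §2.2 ALGO 1]

## References

* K. S. Chua, *Real zeros of Dedekind zeta functions of real quadratic fields*, Math. Comp. 74 (2005)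
  1457–1470, §2.2 ALGO 1. [Chua2005RealZeros]
* H. L. Montgomery, R. C. Vaughan, *Multiplicative Number Theory I*, CUP 2007, §9.3 Thm 9.13. [MontgomeryVaughan2007]
-/

namespace Literature.NumberTheory.LFunctions

namespace LTruncationCert

open FeketePolyaKernel PrimitiveQuadratic

/-! ### Re-normalised period passes -/

/-- Re-match an integer against numeral patterns (forces the kernel to normalise it; always `true`,
`forceZ_eq_true`). [folklore] -/
def forceZ : ℤ → Bool
  | Int.ofNat 0 => true
  | Int.ofNat (_ + 1) => true
  | Int.negSucc 0 => true
  | Int.negSucc (_ + 1) => true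

/-- `forceZ y = true` (re-normalisation is semantically the identity). [cite: Chua2005RealZeros, §2.2 ALGO 1] -/
@[simp] theorem forceZ_eq_true (y : ℤ) : forceZ y = true := by
  rcases y with (_ | _) | (_ | _) <;> rfl

/-- `sums` (running `S`, `U`, `max |U|`) with every accumulator re-normalised at every step and the running
maximum kept in control flow. [folklore] -/
def sumsN (v : ℕ → ℤ) : ℕ → ℕ → ℤ → ℤ → ℕ → ℤ × ℤ × ℕ
  | 0, _, s, u, B => (s, u, B)
  | fuel + 1, t, s, u, B =>
    let sn := s + v (t + 1)
    let un := u + sn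
    let x := un.natAbs
    bif forceZ sn && forceZ un then
      (match t + 1 with
        | 0 => (sn, un, B)
        | t' + 1 => bif Nat.ble B x then sumsN v fuel (t' + 1) sn un x else sumsN v fuel (t' + 1) sn un B)
    else (sn, un, B)

/-- `sumsNeg` (running `S`, `U`, `max (−U)⁺`) re-normalised at every step. [folklore] -/
def sumsNegN (v : ℕ → ℤ) : ℕ → ℕ → ℤ → ℤ → ℕ → ℤ × ℤ × ℕ
  | 0, _, s, u, B => (s, u, B)
  | fuel + 1, t, s, u, B =>
    let sn := s + v (t + 1)
    let un := u + sn
    let x := (-un).toNat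
    bif forceZ sn && forceZ un then
      (match t + 1 with
        | 0 => (sn, un, B)
        | t' + 1 => bif Nat.ble B x then sumsNegN v fuel (t' + 1) sn un x else sumsNegN v fuel (t' + 1) sn un B)
    else (sn, un, B)

/-- `sumsMean` (running `max (N·U(q) − q·U(N))⁺`) re-normalised at every step. [folklore] -/
def sumsMeanN (v : ℕ → ℤ) (q : ℕ) (Uq : ℤ) : ℕ → ℕ → ℤ → ℤ → ℕ → ℕ
  | 0, _, _, _, B => B
  | fuel + 1, t, s, u, B =>
    let sn := s + v (t + 1)
    let un := u + sn
    let x := ((t + 1 : ℕ) * Uq - (q : ℤ) * un).toNat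
    bif forceZ sn && forceZ un then
      (match t + 1 with
        | 0 => B
        | t' + 1 => bif Nat.ble B x then sumsMeanN v q Uq fuel (t' + 1) sn un x
          else sumsMeanN v q Uq fuel (t' + 1) sn un B)
    else B

/-- `max B x` by `Nat.ble`. [folklore] -/
private theorem max_eq_bif (B x : ℕ) {α : Type} (f : ℕ → α) :
    (bif Nat.ble B x then f x else f B) = f (max B x) := by
  cases h : Nat.ble B x
  · have : ¬ B ≤ x := fun hle ↦ by rw [Nat.ble_eq_true_of_le hle] at h; exact Bool.noConfusion h
    rw [max_eq_left (Nat.le_of_not_le this)]; rfl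
  · rw [max_eq_right (Nat.le_of_ble_eq_true h)]; rfl

/-- **`sumsN = sums`** (the period pass of the algorithm, re-normalised). [cite: Chua2005RealZeros, §2.2 ALGO 1] -/
theorem sumsN_eq (v : ℕ → ℤ) : ∀ (fuel t : ℕ) (s u : ℤ) (B : ℕ),
    sumsN v fuel t s u B = sums v fuel t s u B := by
  intro fuel
  induction fuel with
  | zero => intro t s u B; rfl
  | succ fuel ih =>
    intro t s u B
    simp only [sumsN, sums, forceZ_eq_true, Bool.true_and, cond_true, ih]
    exact max_eq_bif _ _ _

/-- **`sumsNegN = sumsNeg`** (the period pass with drift, re-normalised). [cite: Chua2005RealZeros, §2.2 ALGO 1] -/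
theorem sumsNegN_eq (v : ℕ → ℤ) : ∀ (fuel t : ℕ) (s u : ℤ) (B : ℕ),
    sumsNegN v fuel t s u B = sumsNeg v fuel t s u B := by
  intro fuel
  induction fuel with
  | zero => intro t s u B; rfl
  | succ fuel ih =>
    intro t s u B
    simp only [sumsNegN, sumsNeg, forceZ_eq_true, Bool.true_and, cond_true, ih]
    exact max_eq_bif _ _ _

/-- **`sumsMeanN = sumsMean`** (the period pass with the mean, re-normalised). [cite: Chua2005RealZeros, §2.2 ALGO 1] -/
theorem sumsMeanN_eq (v : ℕ → ℤ) (q : ℕ) (Uq : ℤ) : ∀ (fuel t : ℕ) (s u : ℤ) (B : ℕ),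
    sumsMeanN v q Uq fuel t s u B = sumsMean v q Uq fuel t s u B := by
  intro fuel
  induction fuel with
  | zero => intro t s u B; rfl
  | succ fuel ih =>
    intro t s u B
    simp only [sumsMeanN, sumsMean, forceZ_eq_true, Bool.true_and, cond_true, ih]
    exact max_eq_bif _ _ _

/-! ### The checkers with re-normalised period passes (and root tracking) -/

/-- `certOK` with `sumsN` and the two-phase cell walk (`T ≤ q`). [cite: Chua2005RealZeros, §2.2 ALGO 1] -/
def certOKT (v : ℕ → ℤ) (q J P T : ℕ) : Bool :=
  let su := sumsN v q 0 0 0 0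
  let cells := cellsR v q J P T
  let ρ := (rootEnc q (2 * J) P).1
  let r := isqrtSucc q
  decide (7 ≤ q) && decide (0 < J) && decide (su.1 = 0) && decide (su.2.1 = 0) && decide (0 < r) &&
    cells.all (fun c ↦ decide (0 ≤ c.1) &&
      decide (2 * J * (2 ^ P * 2 ^ P) * su.2.2 + 2 * (q + 1) * r * c.2 <
        2 * (2 * J) * (q + 1) * r * c.1.toNat * ρ))

/-- `certDriftOK` with `sumsNegN` and the two-phase cell walk (`T ≤ Kq`). [cite: Chua2005RealZeros, §2.2 ALGO 1] -/
def certDriftOKT (v : ℕ → ℤ) (q K J P T : ℕ) : Bool :=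
  let N₀ := K * q
  let su := sumsNegN v q 0 0 0 0
  let cells := cellsR v N₀ J P T
  let ρ := (rootEnc N₀ (2 * J) P).1
  let r := isqrtSucc N₀
  decide (7 ≤ q) && decide (1 ≤ K) && decide (0 < J) && decide (0 ≤ su.2.1) && decide (0 < r) &&
    cells.all (fun c ↦ decide (0 ≤ c.1) &&
      decide (2 * J * (2 ^ P * 2 ^ P) * su.2.2 + 2 * (N₀ + 1) * r * c.2 <
        2 * (2 * J) * (N₀ + 1) * r * c.1.toNat * ρ))

/-- `certMeanOK` with `sumsN`/`sumsMeanN` and the two-phase cell walk (`T ≤ Kq`). [cite: Chua2005RealZeros, §2.2 ALGO 1] -/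
def certMeanOKT (v : ℕ → ℤ) (q K J P T : ℕ) : Bool :=
  let N₀ := K * q
  let Uq := (sumsN v q 0 0 0 0).2.1
  let Bn := sumsMeanN v q Uq q 0 0 0 0
  let cells := cellsR v N₀ J P T
  let es := (List.range J).map (fun j ↦ (enc (N₀ + 1) J P (J + j + 1)).1)
  let ρ := (rootEnc N₀ (2 * J) P).1
  let r := isqrtSucc N₀
  decide (7 ≤ q) && decide (1 ≤ K) && decide (0 < J) && decide (0 ≤ Uq) && decide (0 < r) &&
    (cells.zip es).all (fun ce ↦
      decide (((2 * J * (2 ^ P * 2 ^ P) * Bn + 2 * q * r * (N₀ + 1) * ce.1.2 : ℕ) : ℤ) <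
        (2 * (2 * J) * q * r * (N₀ + 1) : ℕ) * (if 0 ≤ ce.1.1 then ce.1.1 * ρ else ce.1.1 * 2 ^ P) +
          ((2 * (2 * J) * r * (N₀ + 1) * 2 ^ P : ℕ) : ℤ) * Uq * ce.2))

/-- **`certOKT = certOK`** (`T ≤ q`). [cite: Chua2005RealZeros, §2.2 ALGO 1] -/
theorem certOKT_eq (v : ℕ → ℤ) (q J P : ℕ) {T : ℕ} (hT : T ≤ q) : certOKT v q J P T = certOK v q J P := by
  rw [← certOKR_eq v q J P hT]
  simp only [certOKT, certOKR, sumsN_eq]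

/-- **`certDriftOKT = certDriftOK`** (`T ≤ Kq`). [cite: Chua2005RealZeros, §2.2 ALGO 1] -/
theorem certDriftOKT_eq (v : ℕ → ℤ) (q K J P : ℕ) {T : ℕ} (hT : T ≤ K * q) :
    certDriftOKT v q K J P T = certDriftOK v q K J P := by
  rw [← certDriftOKR_eq v q K J P hT]
  simp only [certDriftOKT, certDriftOKR, sumsNegN_eq]

/-- **`certMeanOKT = certMeanOK`** (`T ≤ Kq`). [cite: Chua2005RealZeros, §2.2 ALGO 1] -/
theorem certMeanOKT_eq (v : ℕ → ℤ) (q K J P : ℕ) {T : ℕ} (hT : T ≤ K * q) :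
    certMeanOKT v q K J P T = certMeanOK v q K J P := by
  rw [← certMeanOKR_eq v q K J P hT]
  simp only [certMeanOKT, certMeanOKR, sumsN_eq, sumsMeanN_eq]

/-! ### A certificate decided on an equal value function -/

/-- `certOK` for `v` from `certOKT` evaluated on any `w = v` (`T ≤ q`). [cite: Chua2005RealZeros, §2.2 ALGO 1] -/
theorem certOK_of_eqT {v w : ℕ → ℤ} (hwv : w = v) {q J P T : ℕ} (hT : T ≤ q)
    (h : certOKT w q J P T = true) : certOK v q J P = true := by
  subst hwv; exact (certOKT_eq w q J P hT).symm.trans h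

/-- `certDriftOK` for `v` from `certDriftOKT` evaluated on any `w = v` (`T ≤ Kq`). [cite: Chua2005RealZeros, §2.2 ALGO 1] -/
theorem certDriftOK_of_eqT {v w : ℕ → ℤ} (hwv : w = v) {q K J P T : ℕ} (hT : T ≤ K * q)
    (h : certDriftOKT w q K J P T = true) : certDriftOK v q K J P = true := by
  subst hwv; exact (certDriftOKT_eq w q K J P hT).symm.trans h

/-- `certMeanOK` for `v` from `certMeanOKT` evaluated on any `w = v` (`T ≤ Kq`). [cite: Chua2005RealZeros, §2.2 ALGO 1] -/
theorem certMeanOK_of_eqT {v w : ℕ → ℤ} (hwv : w = v) {q K J P T : ℕ} (hT : T ≤ K * q)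
    (h : certMeanOKT w q K J P T = true) : certMeanOK v q K J P = true := by
  subst hwv; exact (certMeanOKT_eq w q K J P hT).symm.trans h

/-! ### Character values from a literal residue table -/

/-- `valOddR tbl = valOdd q` for a literal table `tbl = resTable ps`, `ps` odd primes with product `q > 1`.
[cite: MontgomeryVaughan2007, §9.3 Theorem 9.13] -/
theorem valOddR_eq_of_table {ps : List ℕ} {q : ℕ} (hps : ps.Forall fun p ↦ p.Prime ∧ p ≠ 2)
    (hprod : ps.prod = q) (hq : 1 < q) {tbl : List (ℕ × ℕ)} (htbl : resTable ps = tbl) :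
    valOddR tbl = valOdd q := by
  subst htbl; funext n; exact valOddR_eq hps hprod hq n

/-- `valFourR tbl = valFour m` for a literal table `tbl = resTable ps`, `ps` odd primes with product `m > 1`.
[cite: MontgomeryVaughan2007, §9.3 Theorem 9.13] -/
theorem valFourR_eq_of_table {ps : List ℕ} {m : ℕ} (hps : ps.Forall fun p ↦ p.Prime ∧ p ≠ 2)
    (hprod : ps.prod = m) (hm : 1 < m) {tbl : List (ℕ × ℕ)} (htbl : resTable ps = tbl) :
    valFourR tbl = valFour m := by
  subst htbl; funext n; exact valFourR_eq hps hprod hm n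

/-- `valEightAR tbl = valEightA m` for a literal table `tbl = resTable ps`. [cite: MontgomeryVaughan2007, §9.3 Theorem 9.13] -/
theorem valEightAR_eq_of_table {ps : List ℕ} {m : ℕ} (hps : ps.Forall fun p ↦ p.Prime ∧ p ≠ 2)
    (hprod : ps.prod = m) (hm : 1 < m) {tbl : List (ℕ × ℕ)} (htbl : resTable ps = tbl) :
    valEightAR tbl = valEightA m := by
  subst htbl; funext n; exact valEightAR_eq hps hprod hm n

/-- `valEightBR tbl = valEightB m` for a literal table `tbl = resTable ps`. [cite: MontgomeryVaughan2007, §9.3 Theorem 9.13] -/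
theorem valEightBR_eq_of_table {ps : List ℕ} {m : ℕ} (hps : ps.Forall fun p ↦ p.Prime ∧ p ≠ 2)
    (hprod : ps.prod = m) (hm : 1 < m) {tbl : List (ℕ × ℕ)} (htbl : resTable ps = tbl) :
    valEightBR tbl = valEightB m := by
  subst htbl; funext n; exact valEightBR_eq hps hprod hm n

/-! ### Per-conductor wrappers, EVEN characters over the drift checker (parity test or certificate) -/

/-- **Even characters of odd conductor `q`** by the DRIFT checker: either `((q−1)/q) = −1` (the character is odd —
excluded) or `certDriftOK (valOdd q) q K J P` passes. [cite: Chua2005RealZeros, §2.2 ALGO 1] -/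
theorem good_even_of_odd_drift {q : ℕ} [NeZero q] (hq2 : q % 2 = 1) (hq1 : 1 < q) (K J P : ℕ)
    (h : valOdd q (q - 1) = -1 ∨ certDriftOK (valOdd q) q K J P = true) :
    ∀ χ : DirichletCharacter ℂ q, χ.IsQuadratic → χ.IsPrimitive → χ.Even →
      ∀ σ : ℝ, 0 < σ → σ < 1 → χ.LFunction σ ≠ 0 := by
  intro χ hquad hprim heven σ hσ0 hσ1
  have hv := re_apply_eq_valOdd (Nat.odd_iff.mpr hq2) hq1 hprim hquad
  rcases h with hpar | hcert
  · exact (not_even_of_val _ hv hpar heven).elim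
  · exact lfunction_ne_zero_of_certDriftOK hprim hquad hv hcert σ hσ0 hσ1

/-- **Even characters of conductor `4m`** by the drift checker, keyed on `q = 4m`. [cite: Chua2005RealZeros, §2.2 ALGO 1] -/
theorem good_even_of_four_drift {q : ℕ} [NeZero q] (hq8 : q % 8 = 4) (hq1 : 4 < q) (K J P : ℕ)
    (h : valFour (q / 4) (q - 1) = -1 ∨ certDriftOK (valFour (q / 4)) q K J P = true) :
    ∀ χ : DirichletCharacter ℂ q, χ.IsQuadratic → χ.IsPrimitive → χ.Even →
      ∀ σ : ℝ, 0 < σ → σ < 1 → χ.LFunction σ ≠ 0 := by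
  obtain ⟨m, rfl⟩ : ∃ m, q = 4 * m := ⟨q / 4, by omega⟩
  haveI : NeZero m := ⟨by omega⟩
  rw [Nat.mul_div_cancel_left m (by norm_num : 0 < 4)] at h
  intro χ hquad hprim heven σ hσ0 hσ1
  have hv := re_apply_eq_valFour (m := m) (Nat.odd_iff.mpr (by omega)) (by omega) hprim hquad
  rcases h with hpar | hcert
  · exact (not_even_of_val _ hv hpar heven).elim
  · exact lfunction_ne_zero_of_certDriftOK hprim hquad hv hcert σ hσ0 hσ1

/-- **Even characters of conductor `8m`** by the drift checker, keyed on `q = 8m`: both value patterns.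
[cite: Chua2005RealZeros, §2.2 ALGO 1] -/
theorem good_even_of_eight_drift {q : ℕ} [NeZero q] (hq16 : q % 16 = 8) (hq1 : 8 < q) (K J P : ℕ)
    (hA : valEightA (q / 8) (q - 1) = -1 ∨ certDriftOK (valEightA (q / 8)) q K J P = true)
    (hB : valEightB (q / 8) (q - 1) = -1 ∨ certDriftOK (valEightB (q / 8)) q K J P = true) :
    ∀ χ : DirichletCharacter ℂ q, χ.IsQuadratic → χ.IsPrimitive → χ.Even →
      ∀ σ : ℝ, 0 < σ → σ < 1 → χ.LFunction σ ≠ 0 := by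
  obtain ⟨m, rfl⟩ : ∃ m, q = 8 * m := ⟨q / 8, by omega⟩
  haveI : NeZero m := ⟨by omega⟩
  rw [Nat.mul_div_cancel_left m (by norm_num : 0 < 8)] at hA hB
  intro χ hquad hprim heven σ hσ0 hσ1
  rcases re_apply_eq_valEight (m := m) (Nat.odd_iff.mpr (by omega)) (by omega) hprim hquad with hv | hv
  · rcases hA with hpar | hcert
    · exact (not_even_of_val _ hv hpar heven).elim
    · exact lfunction_ne_zero_of_certDriftOK hprim hquad hv hcert σ hσ0 hσ1
  · rcases hB with hpar | hcert
    · exact (not_even_of_val _ hv hpar heven).elim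
    · exact lfunction_ne_zero_of_certDriftOK hprim hquad hv hcert σ hσ0 hσ1

/-- Usage / sanity check (kernel `decide`, `≈ 10 s`): the odd character `χ₋₆₀₁₅ = (·/6015)`, `6015 = 3·5·401`,
passes the drift certificate `K = 1`, `J = 1`, `P = 12`, decided by `certDriftOKT` on the literal residue table
of `[3, 5, 401]` with switch point `T = 32` (the same decision costs `≈ 70 s` through `certDriftOK` itself).
[cite: Chua2005RealZeros, §2.2 ALGO 1] -/
example : certDriftOK (valOdd 6015) 6015 1 1 12 = true :=
  certDriftOK_of_eqT
    (valOddR_eq_of_table (ps := [3, 5, 401]) (by norm_num) (by decide) (by decide)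
      (tbl := [(3, 2), (5, 18), (401, 4436140311412247378139563605390312287712527394596350843662283064418223641753432334082160678221054773873778802779382697910)])
      (by decide +kernel))
    (T := 32) (by decide) (by decide +kernel)

end LTruncationCert

end Literature.NumberTheory.LFunctions
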